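import Literature.AlgebraicGeometry.Motives.HodgeLieDuplicateSummand
import Literature.AlgebraicGeometry.Motives.HodgeLieOfAbelianVarietySemisimpleTimesCM
import Literature.AlgebraicGeometry.HodgeTheory.NoTypeIVTimesCMGrouping
import Summits.HodgeConjecture.CorCM.MumfordTateRankOfPowers
import HarnessLib

/-!
# `t(A × B × B) = t(A × B)` and `t(A × B^{m+1}) = t(A × B)`: a repeated isogeny factor does not change the Mumford–Tate rank
# (Moonen–Zarhin 1999 §1: `Hg` depends only on the simple isogeny factors that occur, not on their multiplicities)

COR-CM (cell `pub-hodgecm2`, seat `b27` gen 48, count-neutral Mumford–Tate-rank ladder; theorems only, no definition, no named fact;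
UNCONDITIONAL — nothing here uses or asserts HC_CM).  The tree had the pure-power case `t(B^{m+1}) = t(B)` (`CorCM/MumfordTateRankOfPowers`,
the diagonal `Δ𝔥(H) = 𝔥(H^{⊕ι})`); this file adds a factor `A`: `dim Lie Hg(H¹((A × B) × B)) = dim Lie Hg(H¹(A × B))`
(`Motives/HodgeLieDuplicateSummand`: a duplicate of a summand already present does not change `𝔥`, transported along the Künneth bicones
of `H¹(A × B)` and `H¹((A × B) × B)`), whence by induction and isogeny invariance **`t(X) = t(X')` for `X ∼ A × B^{m+1}`, `X' ∼ A × B`**.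
Use (next step of the lane): the Weil-class argument of `Motives/HodgeLieWeilClassesProductCorner` on `A × E^{g−2}` for Ribet type `(g−1,1)`
computes `t(A × E^{g−2})`, and this file turns it into `t(A × E)`.

* §1 **`finrank_hodgeLie_hodge_one_prod_prod_self_eq`** (`dim Lie Hg(H¹((A × B) × B)) = dim Lie Hg(H¹(A × B))`),
  **`mtRank_hodge_one_eq_of_isIsogenous_prod_prod_self`** (`t(X) = t(X')` for `X ∼ (A × B) × B`, `X' ∼ A × B`).
* §2 **`mtRank_hodge_one_eq_of_isIsogenous_prod_powSucc`** (`t(X) = t(X')` for `X ∼ A × B^{m+1}`, `X' ∼ A × B`).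

## References
* [MoonenZarhin1999LowDim] B. Moonen, Yu. G. Zarhin, Math. Ann. 315 (1999), §1 and §3 (3.1) [corpus: paper:arxiv-math_9901113 pp. 2, 6].
  [cite: MoonenZarhin1999LowDim, §1 and §3]
* [Moonen1999MTNotes] B. Moonen, *Notes on Mumford–Tate groups* (1999), (1.8), (1.13). [cite: Moonen1999MTNotes, (1.8) and (1.13)]
* [Deligne1982HodgeCycles] P. Deligne, LNM 900 (1982), I §3.1 and Prop. 3.4. [cite: Deligne1982HodgeCycles, I §3.1 and Prop. 3.4]
-/

noncomputable section

open CategoryTheory CategoryTheory.Limits Module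

namespace Summit.HodgeConjecture.CorCM

open Literature.AlgebraicGeometry.Motives
open Literature.AlgebraicGeometry.Motives.AbelianVariety
open Literature.AlgebraicGeometry.Motives.HodgeStructure
open Literature.AlgebraicGeometry.HodgeTheory

variable [HodgeTensorFacts.{0, 0}] {X X' : AbelianVariety ℂ} {n n' : ℕ}

/-! ## §1 One duplicate: `(A × B) × B` versus `A × B` -/

/-- **`dim Lie Hg(H¹((A × B) × B)) = dim Lie Hg(H¹(A × B))`** — `H¹((A × B) × B) ≅ H¹(A × B) ⊕ H¹(B)` and `H¹(A × B) ≅ H¹(A) ⊕ H¹(B)` (Künneth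
bicones: pull-backs along the projections and the inclusions `prodLift`), so `H¹(B)` is a DUPLICATE summand and
`finrank_hodgeLie_eq_of_duplicate_summand` applies («`Hg(X × B) = Hg(X)` for `B` a factor of `X`, acting diagonally»).
[cite: MoonenZarhin1999LowDim, §1 and §3] [cite: Moonen1999MTNotes, (1.8) and (1.13)] -/
theorem finrank_hodgeLie_hodge_one_prod_prod_self_eq {A B : AbelianVariety ℂ} {m m' : ℕ} (hP : IsSmoothProjective m ((A.prod B).prod B).X)
    (hP' : IsSmoothProjective m' (A.prod B).X) :
    haveI := BettiUniverse.finite hP 1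
    haveI := BettiUniverse.finite hP' 1
    Module.finrank ℚ (BettiUniverse.hodge exists_isReal_hodgeModel_holds hP 1).hodgeLie =
      Module.finrank ℚ (BettiUniverse.hodge exists_isReal_hodgeModel_holds hP' 1).hodgeLie := by
  classical
  have hA : IsSmoothProjective A.dim A.X := AbelianVariety.isSmoothProjective_holds
  have hB : IsSmoothProjective B.dim B.X := AbelianVariety.isSmoothProjective_holds
  haveI := BettiUniverse.finite hP 1
  haveI := BettiUniverse.finite hP' 1
  haveI := BettiUniverse.finite hA 1
  haveI := BettiUniverse.finite hB 1
  -- the bicone of `H¹(A × B)`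
  let ι₁' := BettiUniverse.pullHodgeHom exists_isReal_hodgeModel_holds hodgePQ_independent_of_hodgeModel_holds hP' hA
    (fst A B).hom.hom.hom 1
  let π₁' := BettiUniverse.pullHodgeHom exists_isReal_hodgeModel_holds hodgePQ_independent_of_hodgeModel_holds hA hP'
    (prodLift (𝟙 A) (0 : A ⟶ B)).hom.hom.hom 1
  let ι₂' := BettiUniverse.pullHodgeHom exists_isReal_hodgeModel_holds hodgePQ_independent_of_hodgeModel_holds hP' hB
    (snd A B).hom.hom.hom 1
  let π₂' := BettiUniverse.pullHodgeHom exists_isReal_hodgeModel_holds hodgePQ_independent_of_hodgeModel_holds hB hP'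
    (prodLift (0 : B ⟶ A) (𝟙 B)).hom.hom.hom 1
  have hsumP' : fst A B ≫ prodLift (𝟙 A) (0 : A ⟶ B) + snd A B ≫ prodLift (0 : B ⟶ A) (𝟙 B) = 𝟙 _ := by
    refine prod_hom_ext ?_ ?_
    · rw [Preadditive.add_comp, Category.assoc, Category.assoc, prodLift_fst, prodLift_fst, Category.comp_id,
        comp_zero, add_zero, Category.id_comp]
    · rw [Preadditive.add_comp, Category.assoc, Category.assoc, prodLift_snd, prodLift_snd, Category.comp_id,
        comp_zero, zero_add, Category.id_comp]
  have hπι₁' : ∀ v, π₁'.toLinearMap (ι₁'.toLinearMap v) = v := fun v => pull_pull_eq_self_of_comp_eq_id (prodLift_fst _ _) v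
  have hπι₂' : ∀ v, π₂'.toLinearMap (ι₂'.toLinearMap v) = v := fun v => pull_pull_eq_self_of_comp_eq_id (prodLift_snd _ _) v
  have hsum' : ∀ v, ι₁'.toLinearMap (π₁'.toLinearMap v) + ι₂'.toLinearMap (π₂'.toLinearMap v) = v := fun v =>
    pull_pull_add_pull_pull_eq_self _ _ _ _ hsumP' v
  -- the bicone of `H¹((A × B) × B)`
  let ι₀ := BettiUniverse.pullHodgeHom exists_isReal_hodgeModel_holds hodgePQ_independent_of_hodgeModel_holds hP hP'
    (fst (A.prod B) B).hom.hom.hom 1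
  let π₀ := BettiUniverse.pullHodgeHom exists_isReal_hodgeModel_holds hodgePQ_independent_of_hodgeModel_holds hP' hP
    (prodLift (𝟙 (A.prod B)) (0 : A.prod B ⟶ B)).hom.hom.hom 1
  let ι₃ := BettiUniverse.pullHodgeHom exists_isReal_hodgeModel_holds hodgePQ_independent_of_hodgeModel_holds hP hB
    (snd (A.prod B) B).hom.hom.hom 1
  let π₃ := BettiUniverse.pullHodgeHom exists_isReal_hodgeModel_holds hodgePQ_independent_of_hodgeModel_holds hB hP
    (prodLift (0 : B ⟶ A.prod B) (𝟙 B)).hom.hom.hom 1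
  have hsumP : fst (A.prod B) B ≫ prodLift (𝟙 (A.prod B)) (0 : A.prod B ⟶ B) +
      snd (A.prod B) B ≫ prodLift (0 : B ⟶ A.prod B) (𝟙 B) = 𝟙 _ := by
    refine prod_hom_ext ?_ ?_
    · rw [Preadditive.add_comp, Category.assoc, Category.assoc, prodLift_fst, prodLift_fst, Category.comp_id,
        comp_zero, add_zero, Category.id_comp]
    · rw [Preadditive.add_comp, Category.assoc, Category.assoc, prodLift_snd, prodLift_snd, Category.comp_id,
        comp_zero, zero_add, Category.id_comp]
  have hπι₀ : ∀ v, π₀.toLinearMap (ι₀.toLinearMap v) = v := fun v => pull_pull_eq_self_of_comp_eq_id (prodLift_fst _ _) v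
  have hπι₃ : ∀ v, π₃.toLinearMap (ι₃.toLinearMap v) = v := fun v => pull_pull_eq_self_of_comp_eq_id (prodLift_snd _ _) v
  have hsum : ∀ v, ι₀.toLinearMap (π₀.toLinearMap v) + ι₃.toLinearMap (π₃.toLinearMap v) = v := fun v =>
    pull_pull_add_pull_pull_eq_self _ _ _ _ hsumP v
  exact finrank_hodgeLie_eq_of_duplicate_summand ι₁' π₁' ι₂' π₂' hπι₁' hπι₂' hsum' ι₀ π₀ ι₃ π₃ hπι₀ hπι₃ hsum

/-- **`t(X) = t(X')` for `X ∼ (A × B) × B` and `X' ∼ A × B`** (isogeny invariance + §1 + `t = dim Lie Hg + 1`).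
[cite: MoonenZarhin1999LowDim, §1 and §3] -/
theorem mtRank_hodge_one_eq_of_isIsogenous_prod_prod_self (hX : IsSmoothProjective n X.X) (hX' : IsSmoothProjective n' X'.X)
    {A B : AbelianVariety ℂ} (h0 : 0 < (A.prod B).dim) (hXP : IsIsogenous X ((A.prod B).prod B)) (hX'P : IsIsogenous X' (A.prod B)) :
    haveI := BettiUniverse.finite hX 1
    haveI := BettiUniverse.finite hX' 1
    (BettiUniverse.hodge exists_isReal_hodgeModel_holds hX 1).mtRank = (BettiUniverse.hodge exists_isReal_hodgeModel_holds hX' 1).mtRank := by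
  haveI := BettiUniverse.finite hX 1
  haveI := BettiUniverse.finite hX' 1
  have hP : IsSmoothProjective ((A.prod B).prod B).dim ((A.prod B).prod B).X := AbelianVariety.isSmoothProjective_holds
  have hP' : IsSmoothProjective (A.prod B).dim (A.prod B).X := AbelianVariety.isSmoothProjective_holds
  haveI := BettiUniverse.finite hP 1
  haveI := BettiUniverse.finite hP' 1
  have hX0 : 0 < X.dim := by
    obtain ⟨g, hg⟩ := hXP
    rw [dim_eq_of_isIsogeny hg, dim_prod]; omega
  have hX'0 : 0 < X'.dim := by
    obtain ⟨g, hg⟩ := hX'P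
    rw [dim_eq_of_isIsogeny hg]; exact h0
  rw [mtRank_hodge_one_eq_finrank_hodgeLie_add_one hX hX0, mtRank_hodge_one_eq_finrank_hodgeLie_add_one hX' hX'0,
    finrank_hodgeLie_hodge_one_eq_of_isIsogenous hX hP hXP, finrank_hodgeLie_hodge_one_eq_of_isIsogenous hX' hP' hX'P,
    finrank_hodgeLie_hodge_one_prod_prod_self_eq hP hP']

/-! ## §2 Powers of a factor: `A × B^{m+1}` versus `A × B` -/

/-- `t(X) = t(X')` for `X ∼ (A × B) × B^{m+1}` and `X' ∼ A × B` — induction on `m`: `(A × B) × B^{m+2} ∼ ((A × B) × B^{m+1}) × B` and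
`(A × B) × B^{m+1} ∼ (A × B^{m+1}) × B` has `B` as a factor, so §1 removes the last `B`. [cite: MoonenZarhin1999LowDim, §1 and §3] -/
theorem mtRank_hodge_one_eq_of_isIsogenous_prod_prod_powSucc (hX : IsSmoothProjective n X.X) (hX' : IsSmoothProjective n' X'.X)
    {A B : AbelianVariety ℂ} (h0 : 0 < (A.prod B).dim) (m : ℕ) (hXP : IsIsogenous X ((A.prod B).prod (B.powSucc m)))
    (hX'P : IsIsogenous X' (A.prod B)) :
    haveI := BettiUniverse.finite hX 1
    haveI := BettiUniverse.finite hX' 1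
    (BettiUniverse.hodge exists_isReal_hodgeModel_holds hX 1).mtRank = (BettiUniverse.hodge exists_isReal_hodgeModel_holds hX' 1).mtRank := by
  induction m generalizing X n with
  | zero =>
    rw [powSucc_zero] at hXP
    exact mtRank_hodge_one_eq_of_isIsogenous_prod_prod_self hX hX' h0 hXP hX'P
  | succ m ih =>
    -- `C := (A × B) × B^{m+1}`, `X ∼ C × B`, and `C ∼ (A × B^{m+1}) × B`
    have hC : IsSmoothProjective ((A.prod B).prod (B.powSucc m)).dim ((A.prod B).prod (B.powSucc m)).X :=
      AbelianVariety.isSmoothProjective_holds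
    have hXC : IsIsogenous X (((A.prod B).prod (B.powSucc m)).prod B) := by
      rw [powSucc_succ] at hXP
      exact hXP.trans (isIsogenous_prod_assoc (A.prod B) (B.powSucc m) B).symm'
    have hCshape : IsIsogenous ((A.prod B).prod (B.powSucc m)) ((A.prod (B.powSucc m)).prod B) :=
      (isIsogenous_prod_assoc A B (B.powSucc m)).trans
        (((IsIsogenous.refl A).prod (isIsogenous_prod_comm B (B.powSucc m))).trans (isIsogenous_prod_assoc A (B.powSucc m) B).symm')
    have h0' : 0 < ((A.prod (B.powSucc m)).prod B).dim := by
      rw [dim_prod, dim_prod]; rw [dim_prod] at h0; omega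
    -- remove the last `B`: `t(X) = t(C)`
    have h1 := mtRank_hodge_one_eq_of_isIsogenous_prod_prod_self hX hC h0'
      (hXC.trans (hCshape.prod (IsIsogenous.refl B))) hCshape
    rw [h1]
    exact ih hC (IsIsogenous.refl _)

/-- **`t(X) = t(X')` for `X ∼ A × B^{m+1}` and `X' ∼ A × B`: the Mumford–Tate rank only sees WHICH factors occur, not how often** (Moonen–Zarhin §1;
the tree's `CorCM/MumfordTateRankOfPowers` is the case without `A`).  `A × B^{m+2} ∼ (A × B) × B^{m+1}` and the previous lemma.
[cite: MoonenZarhin1999LowDim, §1 and §3] [cite: Moonen1999MTNotes, (1.8) and (1.13)] -/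
theorem mtRank_hodge_one_eq_of_isIsogenous_prod_powSucc (hX : IsSmoothProjective n X.X) (hX' : IsSmoothProjective n' X'.X)
    {A B : AbelianVariety ℂ} (h0 : 0 < (A.prod B).dim) (m : ℕ) (hXP : IsIsogenous X (A.prod (B.powSucc m)))
    (hX'P : IsIsogenous X' (A.prod B)) :
    haveI := BettiUniverse.finite hX 1
    haveI := BettiUniverse.finite hX' 1
    (BettiUniverse.hodge exists_isReal_hodgeModel_holds hX 1).mtRank = (BettiUniverse.hodge exists_isReal_hodgeModel_holds hX' 1).mtRank := by
  cases m with
  | zero =>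
    haveI := BettiUniverse.finite hX 1
    haveI := BettiUniverse.finite hX' 1
    have hP' : IsSmoothProjective (A.prod B).dim (A.prod B).X := AbelianVariety.isSmoothProjective_holds
    haveI := BettiUniverse.finite hP' 1
    rw [powSucc_zero] at hXP
    have hX0 : 0 < X.dim := by
      obtain ⟨g, hg⟩ := hXP
      rw [dim_eq_of_isIsogeny hg]; exact h0
    have hX'0 : 0 < X'.dim := by
      obtain ⟨g, hg⟩ := hX'P
      rw [dim_eq_of_isIsogeny hg]; exact h0
    rw [mtRank_hodge_one_eq_finrank_hodgeLie_add_one hX hX0, mtRank_hodge_one_eq_finrank_hodgeLie_add_one hX' hX'0,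
      finrank_hodgeLie_hodge_one_eq_of_isIsogenous hX hP' hXP, finrank_hodgeLie_hodge_one_eq_of_isIsogenous hX' hP' hX'P]
  | succ m =>
    -- `A × B^{m+2} = A × (B^{m+1} × B) ∼ (A × B) × B^{m+1}`
    have hXP' : IsIsogenous X ((A.prod B).prod (B.powSucc m)) := by
      rw [powSucc_succ] at hXP
      exact hXP.trans ((((IsIsogenous.refl A).prod (isIsogenous_prod_comm (B.powSucc m) B))).trans
        (isIsogenous_prod_assoc A B (B.powSucc m)).symm')
    exact mtRank_hodge_one_eq_of_isIsogenous_prod_prod_powSucc hX hX' h0 m hXP' hX'P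

end Summit.HodgeConjecture.CorCM

end
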